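import Literature.Topology.FourManifolds.LevelFlowOrientation
import Literature.Topology.FourManifolds.LowerPairOfMaps
import Literature.Topology.FourManifolds.LowerPairCorrection
import Literature.Topology.FourManifolds.HandleFeetOrientation
import Literature.Topology.FourManifolds.HandleStepAssembly
import Literature.Topology.FourManifolds.HandleSideConstruction
import Literature.Topology.FourManifolds.Morse
import Literature.Topology.FourManifolds.ClosedBallProofs
import HarnessLib

/-!
# The handle-extension step for one `1`-handle: the context after the two sides are built

Topic `Literature/Topology/FourManifolds` (fact seat
`provefact-Literature.Topology.FourManifolds.IsHandlebody.exists_diffeomorph_isBoundaryGluing_sphere`,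
step F2b₁ of the Lickorish–Wallace DAG; assembly of the level step H of the reduction of L1
`oneHandle_nonempty_diffeomorph`, `HandleAttachmentNormalisation.lean`).  Everything here is
**proved**; no named facts.

The step compares two compact manifolds with boundary `M`, `M'` carrying adapted Morse
functions with a single critical point, of index `1`, above a regular level, given a
level-preserving diffeomorphism of the sublevel sets.  After the preparations (heights matched,
Morse charts chosen, handle sides built with the field of `M` pulled back from that of `M'` on
the seed collar — `OneHandleStepExists.lean`), all data are collected in the structure
`OneHandleStepContext`: the two handle sides `S`, `S'` (`HandleConjugation.lean`) with pinned
constants, the seed maps `g₀`, `g₀'` (smooth, level-shifting, mutually inverse below the level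
`c + 2τ`, with related fields on `f⁻¹(c - τ, c + τ)`), regularity of all levels from `c - 5τ`
up to the top except at the critical point, connectedness of the seed level and orientations of
`M`, `M'`.  This file derives from it: the unit-speed slabs of the two sides
(`HandleSide.unitSlab`: unit speed on `f⁻¹(ℓ₁, a + 2η)`, the core lying above `a + 2η`), the
interior and regularity of the relevant sublevel sets, and the **seed lower pair**
(`OneHandleStepContext.seed`, `IsLowerPair.of_maps`).

## References

* J. Milnor, *Lectures on the h-cobordism theorem* (1965), proofs of Thm. 3.4 (PDF p. 13) and
  Thm. 3.13 (PDF pp. 18–19). [MilnorHCobordism1965]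
-/

open scoped Manifold ContDiff Topology
open Set Function Filter Metric Module

noncomputable section

namespace Literature.Topology.FourManifolds

universe u

/-! ### The unit-speed slab of a handle side -/

namespace HandleSide

variable {n : ℕ} {M : Type u} [TopologicalSpace M] [ChartedSpace (EuclideanHalfSpace (n + 1)) M]
  [IsManifold (𝓡∂ (n + 1)) ∞ M] (S : HandleSide (𝓡∂ (n + 1)) M)

/-- **The unit-speed slab of a handle side below its core**: on `f⁻¹(lo, hi)` with
`ℓ₁ ≤ lo < hi ≤ f p - 4r²`, `hi ≤ ℓ₂`, the field has unit speed (the core, where the speed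
drops, lies within `4r²` of the critical level). [cite: MilnorHCobordism1965, proof of Thm. 3.4 (PDF p. 13)] -/
@[reducible] def unitSlab {lo hi : ℝ} (hlo : S.ℓ₁ ≤ lo) (hlohi : lo < hi) (hhi : hi + 4 * S.D.r ^ 2 ≤ S.f S.p) (hhi₂ : hi ≤ S.ℓ₂) :
    UnitSlab (n := n) M where
  f := S.f
  X := S.X
  θ := S.θ
  hf := S.hf
  flow := S.flow
  lo := lo
  hi := hi
  lo_lt_hi := hlohi
  unit x hx := by
    refine S.hunit x ⟨by linarith [hx.1], by linarith [hx.2]⟩ fun hc => ?_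
    have := S.D.abs_sub_lt_of_mem_core hc
    rw [abs_lt] at this
    linarith [hx.2, this.1]

end HandleSide

/-! ### The context -/

variable {n : ℕ} {M : Type u} [TopologicalSpace M] [ChartedSpace (EuclideanHalfSpace (n + 1)) M]
  [IsManifold (𝓡∂ (n + 1)) ∞ M]
  {M' : Type u} [TopologicalSpace M'] [ChartedSpace (EuclideanHalfSpace (n + 1)) M'] [IsManifold (𝓡∂ (n + 1)) ∞ M']

variable (n M M') in
/-- **The context of the handle-extension step for one `1`-handle** (see the module docstring).
[cite: MilnorHCobordism1965, proof of Thm. 3.13 (PDF pp. 18–19)] -/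
structure OneHandleStepContext where
  /-- The handle side of `M`. -/
  S : HandleSide (𝓡∂ (n + 1)) M
  /-- The handle side of `M'`. -/
  S' : HandleSide (𝓡∂ (n + 1)) M'
  hn : 2 ≤ n
  hF : IsMorseAdapted (𝓡∂ (n + 1)) S.f
  hF' : IsMorseAdapted (𝓡∂ (n + 1)) S'.f
  /-- The level shift. -/
  σ : ℝ
  /-- The seed level. -/
  c : ℝ
  /-- The seed width. -/
  τ : ℝ
  τ_pos : 0 < τ
  hk : S.D.k = 1
  hk' : S'.D.k = 1
  hr : S'.D.r = S.D.r
  hε : S'.ε = S.ε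
  hγ : S'.γ = S.γ
  hη : S'.η = S.η
  hδ : S'.δ = S.δ
  ha : S'.a = S.a + σ
  hℓ₁ : S'.ℓ₁ = S.ℓ₁ + σ
  hℓ₂ : S'.ℓ₂ = S.ℓ₂ + σ
  hℓu : S'.ℓu = S.ℓu + σ
  hfp : S'.f S'.p = S.f S.p + σ
  hr_eq : S.D.r = S.ε / 10
  hγ_eq : S.γ = 32 * S.D.r ^ 4
  ha_eq : S.a = S.f S.p - S.ε ^ 2 / 2
  hℓu_eq : S.ℓu = S.f S.p + S.ε ^ 2
  hδ_eq : S.δ = S.ε ^ 2 / 100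
  hℓ₁_eq : S.ℓ₁ = c - 4 * τ
  hℓ₂_eq : S.ℓ₂ = S.f S.p + 16 * S.ε ^ 2
  hε1 : S.ε ≤ 1 / 4
  hτε : τ ≤ S.ε ^ 2 / 100
  hηε : S.η ≤ S.ε ^ 2 / 100
  hητ : 9 * S.η ≤ τ
  hcτ : c + 8 * τ ≤ S.f S.p - 25 * S.ε ^ 2
  htop : S.f S.p + 17 * S.ε ^ 2 < 1
  htop' : S'.f S'.p + 17 * S.ε ^ 2 < 1
  hreg : ∀ x, c - 5 * τ ≤ S.f x → x ≠ S.p → ¬ IsMCriticalPt (𝓡∂ (n + 1)) S.f x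
  hreg' : ∀ y, c + σ - 5 * τ ≤ S'.f y → y ≠ S'.p → ¬ IsMCriticalPt (𝓡∂ (n + 1)) S'.f y
  /-- The seed map. -/
  g₀ : M → M'
  /-- Its inverse. -/
  g₀' : M' → M
  hg₀ : ∀ x, S.f x < c + 2 * τ → ContMDiffAt (𝓡∂ (n + 1)) (𝓡∂ (n + 1)) ∞ g₀ x
  hg₀' : ∀ y, S'.f y < c + σ + 2 * τ → ContMDiffAt (𝓡∂ (n + 1)) (𝓡∂ (n + 1)) ∞ g₀' y
  hlev₀ : ∀ x, S.f x ≤ c + 2 * τ → S'.f (g₀ x) = S.f x + σ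
  hlev₀' : ∀ y, S'.f y ≤ c + σ + 2 * τ → S.f (g₀' y) = S'.f y - σ
  hinv₀ : ∀ x, S.f x ≤ c + 2 * τ → g₀' (g₀ x) = x
  hinv₀' : ∀ y, S'.f y ≤ c + σ + 2 * τ → g₀ (g₀' y) = y
  hrel₀ : ∀ x, S.f x ∈ Ioo (c - τ) (c + τ) →
    mfderiv (𝓡∂ (n + 1)) (𝓡∂ (n + 1)) g₀ x (S.X x) = S'.X (g₀ x)
  hconn : IsConnected (S.f ⁻¹' {c})
  /-- An orientation of `M`. -/
  oM : SmoothOrientation (𝓡∂ (n + 1)) M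
  /-- An orientation of `M'`. -/
  oM' : SmoothOrientation (𝓡∂ (n + 1)) M'

namespace OneHandleStepContext

variable (C : OneHandleStepContext n M M')

/-! #### Arithmetic of the constants -/

/-- `0 < ε`. [folklore] -/
theorem ε_pos : 0 < C.S.ε := C.S.ε_pos
/-- `0 < η`. [folklore] -/
theorem η_pos : 0 < C.S.η := C.S.η_pos
/-- `0 < r`. [folklore] -/
theorem r_pos : 0 < C.S.D.r := C.S.D.r_pos

/-- The seed band lies far below the cut level: `c + 8τ ≤ a - 24ε²`. [folklore] -/
theorem c_le : C.c + 8 * C.τ ≤ C.S.a - 24 * C.S.ε ^ 2 := by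
  have := C.hcτ; rw [C.ha_eq]; linarith [sq_nonneg C.S.ε]

/-- `a + 2η + 4r² ≤ f p` (the core lies above the slab). [folklore] -/
theorem a_two_η_le : C.S.a + 2 * C.S.η + 4 * C.S.D.r ^ 2 ≤ C.S.f C.S.p := by
  rw [C.ha_eq, C.hr_eq]
  have hε := C.ε_pos; have := C.hηε
  nlinarith

/-- `ℓ₁ ≤ c - 4τ < c - τ`. [folklore] -/
theorem ℓ₁_lt : C.S.ℓ₁ < C.c + C.τ := by rw [C.hℓ₁_eq]; linarith [C.τ_pos]

/-- `a + 2η ≤ ℓ₂`. [folklore] -/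
theorem a_two_η_le_ℓ₂ : C.S.a + 2 * C.S.η ≤ C.S.ℓ₂ := by
  have := C.a_two_η_le; rw [C.hℓ₂_eq]; nlinarith [C.ε_pos]

/-! #### The unit-speed slabs -/

/-- **The unit-speed slab of `M`**: `f⁻¹(ℓ₁, a + 2η)`. [cite: MilnorHCobordism1965, proof of Thm. 3.4 (PDF p. 13)] -/
@[reducible] def Sl : UnitSlab (n := n) M :=
  C.S.unitSlab (lo := C.S.ℓ₁) (hi := C.S.a + 2 * C.S.η) le_rfl
    (by have := C.c_le; have := C.ℓ₁_lt; linarith [C.τ_pos, sq_nonneg C.S.ε, C.η_pos]) C.a_two_η_le C.a_two_η_le_ℓ₂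

/-- Unfolding. [folklore] -/
@[simp] theorem Sl_f : C.Sl.f = C.S.f := rfl
/-- Unfolding. [folklore] -/
@[simp] theorem Sl_X : C.Sl.X = C.S.X := rfl
/-- Unfolding. [folklore] -/
@[simp] theorem Sl_θ : C.Sl.θ = C.S.θ := rfl
/-- Unfolding. [folklore] -/
@[simp] theorem Sl_lo : C.Sl.lo = C.S.ℓ₁ := rfl
/-- Unfolding. [folklore] -/
@[simp] theorem Sl_hi : C.Sl.hi = C.S.a + 2 * C.S.η := rfl

/-- The primed constants. [folklore] -/
theorem a'_two_η_le : C.S'.a + 2 * C.S'.η + 4 * C.S'.D.r ^ 2 ≤ C.S'.f C.S'.p := by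
  rw [C.ha, C.hη, C.hr, C.hfp]; linarith [C.a_two_η_le]

/-- `a' + 2η ≤ ℓ₂'`. [folklore] -/
theorem a'_two_η_le_ℓ₂ : C.S'.a + 2 * C.S'.η ≤ C.S'.ℓ₂ := by
  rw [C.ha, C.hη, C.hℓ₂]; linarith [C.a_two_η_le_ℓ₂]

/-- `ℓ₁' < c + σ + τ`. [folklore] -/
theorem ℓ₁'_lt : C.S'.ℓ₁ < C.c + C.σ + C.τ := by rw [C.hℓ₁]; linarith [C.ℓ₁_lt]

/-- **The unit-speed slab of `M'`**: `f'⁻¹(ℓ₁', a' + 2η)`. [cite: MilnorHCobordism1965, proof of Thm. 3.4 (PDF p. 13)] -/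
@[reducible] def Sl' : UnitSlab (n := n) M' :=
  C.S'.unitSlab (lo := C.S'.ℓ₁) (hi := C.S'.a + 2 * C.S'.η) le_rfl
    (by have := C.c_le; have := C.ℓ₁'_lt; rw [C.ha, C.hη]; linarith [C.τ_pos, sq_nonneg C.S.ε, C.η_pos])
    C.a'_two_η_le C.a'_two_η_le_ℓ₂

/-- Unfolding. [folklore] -/
@[simp] theorem Sl'_f : C.Sl'.f = C.S'.f := rfl
/-- Unfolding. [folklore] -/
@[simp] theorem Sl'_X : C.Sl'.X = C.S'.X := rfl
/-- Unfolding. [folklore] -/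
@[simp] theorem Sl'_θ : C.Sl'.θ = C.S'.θ := rfl
/-- Unfolding. [folklore] -/
@[simp] theorem Sl'_lo : C.Sl'.lo = C.S'.ℓ₁ := rfl
/-- Unfolding. [folklore] -/
@[simp] theorem Sl'_hi : C.Sl'.hi = C.S'.a + 2 * C.S'.η := rfl

/-! #### Interior and regular levels -/

/-- **Sublevel sets below `1` are interior.** [cite: MilnorHCobordism1965, Def. 3.1] -/
theorem isInteriorPoint_of_lt {x : M} (hx : C.S.f x < 1) : (𝓡∂ (n + 1)).IsInteriorPoint x :=
  ((𝓡∂ (n + 1)).isInteriorPoint_or_isBoundaryPoint x).resolve_right fun hb => by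
    have := (C.hF.2.1 x hb).1; linarith

/-- Sublevel sets below `1` are interior (`M'`). [cite: MilnorHCobordism1965, Def. 3.1] -/
theorem isInteriorPoint_of_lt' {y : M'} (hy : C.S'.f y < 1) : (𝓡∂ (n + 1)).IsInteriorPoint y :=
  ((𝓡∂ (n + 1)).isInteriorPoint_or_isBoundaryPoint y).resolve_right fun hb => by
    have := (C.hF'.2.1 y hb).1; linarith

/-- **The levels of the slab are regular** (unit speed). [folklore] -/
theorem not_isMCriticalPt_of_mem {x : M} (hx : C.S.f x ∈ Ioo C.S.ℓ₁ (C.S.a + 2 * C.S.η)) :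
    ¬ IsMCriticalPt (𝓡∂ (n + 1)) C.S.f x :=
  not_isMCriticalPt_of_mlineDeriv_pos (v := C.S.X x) (by rw [show mlineDeriv _ C.S.f x (C.S.X x) = 1 from C.Sl.unit x hx]; exact one_pos)

/-- The levels of the slab of `M'` are regular. [folklore] -/
theorem not_isMCriticalPt_of_mem' {y : M'} (hy : C.S'.f y ∈ Ioo C.S'.ℓ₁ (C.S'.a + 2 * C.S'.η)) :
    ¬ IsMCriticalPt (𝓡∂ (n + 1)) C.S'.f y :=
  not_isMCriticalPt_of_mlineDeriv_pos (v := C.S'.X y) (by rw [show mlineDeriv _ C.S'.f y (C.S'.X y) = 1 from C.Sl'.unit y hy]; exact one_pos)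

/-- `a + 2η < 1`. [folklore] -/
theorem a_two_η_lt_one : C.S.a + 2 * C.S.η < 1 := by
  have := C.a_two_η_le; have := C.htop; linarith [sq_nonneg C.S.ε, sq_nonneg C.S.D.r]

/-- `a' + 2η < 1`. [folklore] -/
theorem a'_two_η_lt_one : C.S'.a + 2 * C.S'.η < 1 := by
  have := C.a'_two_η_le; have := C.htop'; linarith [sq_nonneg C.S.ε, sq_nonneg C.S'.D.r]

/-- Interior hypothesis for a sublevel set of the slab. [folklore] -/
theorem hint {ℓ : ℝ} (hℓ : ℓ ≤ C.S.a + 2 * C.S.η) : ∀ p, C.S.f p ≤ ℓ → (𝓡∂ (n + 1)).IsInteriorPoint p :=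
  fun _ hp => C.isInteriorPoint_of_lt (by linarith [C.a_two_η_lt_one])

/-- Interior hypothesis for a sublevel set of the slab of `M'`. [folklore] -/
theorem hint' {ℓ : ℝ} (hℓ : ℓ ≤ C.S'.a + 2 * C.S'.η) : ∀ p, C.S'.f p ≤ ℓ → (𝓡∂ (n + 1)).IsInteriorPoint p :=
  fun _ hp => C.isInteriorPoint_of_lt' (by linarith [C.a'_two_η_lt_one])

/-- Regularity hypothesis for a level of the slab. [folklore] -/
theorem hreg_level {ℓ : ℝ} (hℓ : ℓ ∈ Ioo C.S.ℓ₁ (C.S.a + 2 * C.S.η)) :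
    ∀ p, C.S.f p = ℓ → ¬ IsMCriticalPt (𝓡∂ (n + 1)) C.S.f p :=
  fun p hp => C.not_isMCriticalPt_of_mem (by rw [hp]; exact hℓ)

/-- Regularity hypothesis for a level of the slab of `M'`. [folklore] -/
theorem hreg_level' {ℓ : ℝ} (hℓ : ℓ ∈ Ioo C.S'.ℓ₁ (C.S'.a + 2 * C.S'.η)) :
    ∀ p, C.S'.f p = ℓ → ¬ IsMCriticalPt (𝓡∂ (n + 1)) C.S'.f p :=
  fun p hp => C.not_isMCriticalPt_of_mem' (by rw [hp]; exact hℓ)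

/-- **The structure of the sublevel set** `{f ≤ ℓ}` for a level of the slab. [folklore] -/
@[reducible] def cs {ℓ : ℝ} (hℓ : ℓ ∈ Ioo C.S.ℓ₁ (C.S.a + 2 * C.S.η)) : ChartedSpace (EuclideanHalfSpace (n + 1)) ↥(C.S.f ⁻¹' Iic ℓ) :=
  (sublevelAtlas C.S.hf ℓ (C.hint hℓ.2.le) (C.hreg_level hℓ)).chartedSpace

/-- The structure of `{f' ≤ ℓ}` for a level of the slab of `M'`. [folklore] -/
@[reducible] def cs' {ℓ : ℝ} (hℓ : ℓ ∈ Ioo C.S'.ℓ₁ (C.S'.a + 2 * C.S'.η)) : ChartedSpace (EuclideanHalfSpace (n + 1)) ↥(C.S'.f ⁻¹' Iic ℓ) :=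
  (sublevelAtlas C.S'.hf ℓ (C.hint' hℓ.2.le) (C.hreg_level' hℓ)).chartedSpace

/-- The sublevel sets of the slab are manifolds with boundary. [folklore] -/
theorem isManifold_cs {ℓ : ℝ} (hℓ : ℓ ∈ Ioo C.S.ℓ₁ (C.S.a + 2 * C.S.η)) :
    letI := C.cs hℓ; IsManifold (𝓡∂ (n + 1)) ∞ ↥(C.S.f ⁻¹' Iic ℓ) :=
  (sublevelAtlas C.S.hf ℓ (C.hint hℓ.2.le) (C.hreg_level hℓ)).isManifold

/-- The sublevel sets of the slab of `M'` are manifolds with boundary. [folklore] -/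
theorem isManifold_cs' {ℓ : ℝ} (hℓ : ℓ ∈ Ioo C.S'.ℓ₁ (C.S'.a + 2 * C.S'.η)) :
    letI := C.cs' hℓ; IsManifold (𝓡∂ (n + 1)) ∞ ↥(C.S'.f ⁻¹' Iic ℓ) :=
  (sublevelAtlas C.S'.hf ℓ (C.hint' hℓ.2.le) (C.hreg_level' hℓ)).isManifold

/-! #### The seed lower pair -/

/-- **The seed lower pair** at the level `c + τ`, of width `τ/3`. [cite: MilnorHCobordism1965, proof of Thm. 3.13 (PDF pp. 18–19)] -/
theorem seed [T2Space M'] : IsLowerPair C.Sl C.Sl' C.σ (C.c + C.τ) (C.τ / 3) C.g₀ C.g₀' :=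
  IsLowerPair.of_maps C.Sl C.Sl' C.τ_pos (by show C.S.ℓ₁ ≤ C.c - C.τ; rw [C.hℓ₁_eq]; linarith [C.τ_pos])
    (by show C.c + C.τ ≤ C.S.a + 2 * C.S.η; linarith [C.c_le, C.τ_pos, sq_nonneg C.S.ε, C.η_pos])
    (fun x hx => C.hg₀ x (by have hx' : C.S.f x < C.c + C.τ := hx; linarith [C.τ_pos]))
    (fun y hy => C.hg₀' y (by have hy' : C.S'.f y < C.c + C.σ + C.τ := hy; linarith [C.τ_pos]))
    (fun x hx => C.hlev₀ x (by have hx' : C.S.f x < C.c + C.τ := hx; linarith [C.τ_pos]))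
    (fun y hy => C.hlev₀' y (by have hy' : C.S'.f y < C.c + C.σ + C.τ := hy; linarith [C.τ_pos]))
    (fun x hx => C.hinv₀ x (by have hx' : C.S.f x < C.c + C.τ := hx; linarith [C.τ_pos]))
    (fun y hy => C.hinv₀' y (by have hy' : C.S'.f y < C.c + C.σ + C.τ := hy; linarith [C.τ_pos]))
    C.S'.hX C.hrel₀

/-! #### The levels of the feet and of the seed -/

/-- Local notation: `𝔼 n` is the model Euclidean space `EuclideanSpace ℝ (Fin n)`. -/
local notation "𝔼 " n:arg => EuclideanSpace ℝ (Fin n)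

/-- The depth of the feet below the critical level, `m = f p - a = ε²/2`. [folklore] -/
def m : ℝ := C.S.f C.S.p - C.S.a

/-- The depth on `M'`. [folklore] -/
def m' : ℝ := C.S'.f C.S'.p - C.S'.a

/-- `m = ε²/2`. [folklore] -/
theorem m_eq : C.m = C.S.ε ^ 2 / 2 := by rw [m, C.ha_eq]; ring
/-- `m' = ε²/2`. [folklore] -/
theorem m'_eq : C.m' = C.S.ε ^ 2 / 2 := by rw [m', C.ha, C.hfp, C.ha_eq]; ring
/-- `f p - m = a`. [folklore] -/
theorem fp_sub_m : C.S.f C.S.p - C.m = C.S.a := by rw [m]; ring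
/-- `f' p' - m' = a'`. [folklore] -/
theorem fp_sub_m' : C.S'.f C.S'.p - C.m' = C.S'.a := by rw [m']; ring
/-- `1 ≤ n`. [folklore] -/
theorem hn1 (C : OneHandleStepContext n M M') : 1 ≤ n := le_trans (by norm_num) C.hn

/-- The foot level lies in the slab. [folklore] -/
theorem foot_mem : C.S.f C.S.p - C.m ∈ Ioo C.S.ℓ₁ (C.S.a + 2 * C.S.η) := by
  rw [C.fp_sub_m]; exact ⟨by linarith [C.ℓ₁_lt, C.c_le, C.τ_pos, sq_nonneg C.S.ε], by linarith [C.η_pos]⟩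

/-- The seed level lies in the slab. [folklore] -/
theorem c_mem : C.c ∈ Ioo C.S.ℓ₁ (C.S.a + 2 * C.S.η) :=
  ⟨by rw [C.hℓ₁_eq]; linarith [C.τ_pos], by linarith [C.c_le, C.τ_pos, sq_nonneg C.S.ε, C.η_pos]⟩

/-- The foot level of `M'` lies in its slab. [folklore] -/
theorem foot_mem' : C.S'.f C.S'.p - C.m' ∈ Ioo C.S'.ℓ₁ (C.S'.a + 2 * C.S'.η) := by
  rw [C.fp_sub_m', C.ha, C.hη]; exact ⟨by linarith [C.ℓ₁'_lt, C.c_le, C.τ_pos, sq_nonneg C.S.ε], by linarith [C.η_pos]⟩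

/-- The seed level of `M'` lies in its slab. [folklore] -/
theorem c'_mem : C.c + C.σ ∈ Ioo C.S'.ℓ₁ (C.S'.a + 2 * C.S'.η) :=
  ⟨by rw [C.hℓ₁, C.hℓ₁_eq]; linarith [C.τ_pos], by rw [C.ha, C.hη]; linarith [C.c_le, C.τ_pos, sq_nonneg C.S.ε, C.η_pos]⟩

/-- The structure of the sublevel set of the foot level. [folklore] -/
instance instCsFoot : ChartedSpace (EuclideanHalfSpace (n + 1)) ↥(C.S.f ⁻¹' Iic (C.S.f C.S.p - C.m)) := C.cs C.foot_mem
/-- The sublevel set of the foot level is a manifold with boundary. [folklore] -/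
instance instMfdFoot : IsManifold (𝓡∂ (n + 1)) ∞ ↥(C.S.f ⁻¹' Iic (C.S.f C.S.p - C.m)) := C.isManifold_cs C.foot_mem
/-- The structure of the sublevel set of the seed level. [folklore] -/
instance instCsC : ChartedSpace (EuclideanHalfSpace (n + 1)) ↥(C.S.f ⁻¹' Iic C.c) := C.cs C.c_mem
/-- The sublevel set of the seed level is a manifold with boundary. [folklore] -/
instance instMfdC : IsManifold (𝓡∂ (n + 1)) ∞ ↥(C.S.f ⁻¹' Iic C.c) := C.isManifold_cs C.c_mem
/-- The structure of the sublevel set of the foot level of `M'`. [folklore] -/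
instance instCsFoot' : ChartedSpace (EuclideanHalfSpace (n + 1)) ↥(C.S'.f ⁻¹' Iic (C.S'.f C.S'.p - C.m')) := C.cs' C.foot_mem'
/-- The sublevel set of the foot level of `M'` is a manifold with boundary. [folklore] -/
instance instMfdFoot' : IsManifold (𝓡∂ (n + 1)) ∞ ↥(C.S'.f ⁻¹' Iic (C.S'.f C.S'.p - C.m')) := C.isManifold_cs' C.foot_mem'
/-- The structure of the sublevel set of the seed level of `M'`. [folklore] -/
instance instCsC' : ChartedSpace (EuclideanHalfSpace (n + 1)) ↥(C.S'.f ⁻¹' Iic (C.c + C.σ)) := C.cs' C.c'_mem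
/-- The sublevel set of the seed level of `M'` is a manifold with boundary. [folklore] -/
instance instMfdC' : IsManifold (𝓡∂ (n + 1)) ∞ ↥(C.S'.f ⁻¹' Iic (C.c + C.σ)) := C.isManifold_cs' C.c'_mem

/-! #### The transfer data of the feet -/

/-- The radial size of the feet, `ρ = ε/5`. [folklore] -/
def ρ : ℝ := C.S.ε / 5

/-- `0 < ρ`. [folklore] -/
theorem ρ_pos : 0 < C.ρ := by rw [ρ]; linarith [C.ε_pos]
/-- The feet fit in the chart ball: `m + 2ρ² ≤ ε²`. [folklore] -/
theorem hmR : C.m + 2 * C.ρ ^ 2 ≤ C.S.ε ^ 2 := by rw [C.m_eq, ρ]; nlinarith [C.ε_pos]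
/-- The feet of `M'` fit in the chart ball. [folklore] -/
theorem hmR' : C.m' + 2 * C.ρ ^ 2 ≤ C.S'.ε ^ 2 := by rw [C.m'_eq, ρ, C.hε]; nlinarith [C.ε_pos]

/-- **The transfer data of the feet of `M`** (chart ball of radius `ε`, depth `m`).
[cite: Kosinski1993, VI (6.6)] -/
theorem T : C.S.D.TransferData C.S.ε C.m where
  hball := (closedBall_subset_closedBall (by linarith [C.ε_pos])).trans C.S.hball
  hf := C.S.hf
  hint := C.hint C.foot_mem.2.le
  hreg := C.hreg_level C.foot_mem
  hcs := rfl
  hk := C.hk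
  hm := by rw [C.m_eq]; have := C.ε_pos; positivity
  hn := C.hn1
  hR := C.ε_pos

/-- The transfer data of the feet of `M'`. [cite: Kosinski1993, VI (6.6)] -/
theorem T' : C.S'.D.TransferData C.S'.ε C.m' where
  hball := (closedBall_subset_closedBall (by linarith [C.S'.ε_pos])).trans C.S'.hball
  hf := C.S'.hf
  hint := C.hint' C.foot_mem'.2.le
  hreg := C.hreg_level' C.foot_mem'
  hcs := rfl
  hk := C.hk'
  hm := by rw [C.m'_eq]; have := C.ε_pos; positivity
  hn := C.hn1
  hR := C.S'.ε_pos

/-! #### The level diffeomorphisms and the discs at the seed level -/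

/-- **The flow from the foot level down to the seed level.** [cite: MilnorHCobordism1965, Thm. 3.4] -/
def Λ : C.Sl.Level (C.S.f C.S.p - C.m) ≃ₘ⟮𝓡 n, 𝓡 n⟯ C.Sl.Level C.c :=
  C.Sl.levelFlowDiffeomorph rfl rfl C.foot_mem C.c_mem C.hn1

/-- The flow from the foot level down to the seed level on `M'`. [cite: MilnorHCobordism1965, Thm. 3.4] -/
def Λ' : C.Sl'.Level (C.S'.f C.S'.p - C.m') ≃ₘ⟮𝓡 n, 𝓡 n⟯ C.Sl'.Level (C.c + C.σ) :=
  C.Sl'.levelFlowDiffeomorph rfl rfl C.foot_mem' C.c'_mem C.hn1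

/-- **The level diffeomorphism of the seed at the seed level.** [folklore] -/
def Ψlev : C.Sl.Level C.c ≃ₘ⟮𝓡 n, 𝓡 n⟯ C.Sl'.Level (C.c + C.σ) :=
  levelDiffeomorphOfMaps C.Sl C.Sl' rfl rfl (g := C.g₀) (g' := C.g₀')
    (fun x hx => by
      have hx' : C.S.f x = C.c := hx
      show C.S'.f (C.g₀ x) = C.c + C.σ
      rw [C.hlev₀ x (by linarith [C.τ_pos]), hx'])
    (fun y hy => by
      have hy' : C.S'.f y = C.c + C.σ := hy
      show C.S.f (C.g₀' y) = C.c
      rw [C.hlev₀' y (by linarith [C.τ_pos]), hy']; ring)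
    C.hn1 (fun x hx => C.hg₀ x (by have hx' : C.S.f x = C.c := hx; linarith [C.τ_pos]))
    (fun y hy => C.hg₀' y (by have hy' : C.S'.f y = C.c + C.σ := hy; linarith [C.τ_pos]))
    (fun x hx => C.hinv₀ x (by have hx' : C.S.f x = C.c := hx; linarith [C.τ_pos]))
    (fun y hy => C.hinv₀' y (by have hy' : C.S'.f y = C.c + C.σ := hy; linarith [C.τ_pos]))

/-- **The discs of `M` read at the seed level of `M'`**: `Ψ ∘ Λ ∘ (lifted foot)`, `s = ±1`.
[cite: MilnorHCobordism1965, proof of Thm. 3.13 (PDF pp. 18–19)] -/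
def disc {s : ℝ} (hs : s ^ 2 = 1) (w : 𝔼 n) : C.Sl'.Level (C.c + C.σ) :=
  C.Ψlev (C.Λ (C.T.footLift C.ρ_pos C.hmR hs w))

/-- **The discs of `M'` read at the seed level**: `Λ' ∘ (lifted foot)`. [cite: MilnorHCobordism1965, proof of Thm. 3.13 (PDF pp. 18–19)] -/
def disc' {s : ℝ} (hs : s ^ 2 = 1) (w : 𝔼 n) : C.Sl'.Level (C.c + C.σ) :=
  C.Λ' (C.T'.footLift C.ρ_pos C.hmR' hs w)

/-- The canonical orientation of the seed level of `M'`. [cite: HirschDT1976, §4.4 p. 103] -/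
def oV' : SmoothOrientation (𝓡 n) (C.Sl'.Level (C.c + C.σ)) := C.Sl'.levelOrientation rfl C.oM' C.hn1

/-- **The matching condition**: the `+` discs of the two sides have the same orientation
character in the seed level of `M'`. [cite: Kosinski1993, VI (6.6)] -/
structure Match : Prop where
  /-- The `+` discs have the same character. -/
  iff : ∀ o₀ : Orientation ℝ (𝔼 n) (Fin (finrank ℝ (𝔼 n))),
    IsOrientationPreserving (SmoothOrientation.modelSpace o₀) C.oV' (C.disc (one_pow 2)) ↔
      IsOrientationPreserving (SmoothOrientation.modelSpace o₀) C.oV' (C.disc' (one_pow 2))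

/-! #### Properties of the discs -/

/-- Unfolding of `disc`. [folklore] -/
theorem disc_def {s : ℝ} (hs : s ^ 2 = 1) : C.disc hs = C.Ψlev ∘ C.Λ ∘ C.T.footLift C.ρ_pos C.hmR hs := rfl
/-- Unfolding of `disc'`. [folklore] -/
theorem disc'_def {s : ℝ} (hs : s ^ 2 = 1) : C.disc' hs = C.Λ' ∘ C.T'.footLift C.ρ_pos C.hmR' hs := rfl

/-- The discs are smooth embeddings. [cite: LeeSmoothManifolds2013, Prop. 5.2] -/
theorem isSmoothEmbedding_disc {s : ℝ} (hs : s ^ 2 = 1) : Manifold.IsSmoothEmbedding 𝓘(ℝ, 𝔼 n) (𝓡 n) ∞ (C.disc hs) := by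
  rw [C.disc_def hs, ← comp_assoc]
  exact ((C.T.isSmoothEmbedding_footLift C.ρ_pos C.hmR hs).diffeomorph_comp C.Λ).diffeomorph_comp C.Ψlev

/-- The discs of `M'` are smooth embeddings. [cite: LeeSmoothManifolds2013, Prop. 5.2] -/
theorem isSmoothEmbedding_disc' {s : ℝ} (hs : s ^ 2 = 1) : Manifold.IsSmoothEmbedding 𝓘(ℝ, 𝔼 n) (𝓡 n) ∞ (C.disc' hs) :=
  (C.T'.isSmoothEmbedding_footLift C.ρ_pos C.hmR' hs).diffeomorph_comp C.Λ'

/-- The ranges of the discs are open. [folklore] -/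
theorem isOpen_range_footLift {s : ℝ} (hs : s ^ 2 = 1) : IsOpen (range (C.T.footLift C.ρ_pos C.hmR hs)) := by
  have h := isSmoothEmbedding_levelLift C.T.hcs C.T.hn (C.S.D.contMDiff_foot C.T.hm C.T.hR C.hmR C.T.hball hs C.ρ_pos)
    (C.T.apply_foot C.ρ_pos C.hmR hs) C.S.D.isOpen_footDomain
    (C.S.D.range_foot hs C.T.hm C.ρ_pos C.T.hR C.hmR C.T.hball C.T.hk) (C.S.D.contMDiffOn_footInv C.ρ_pos)
    (C.S.D.footInv_foot hs C.T.hm C.ρ_pos C.T.hR C.hmR C.T.hball)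
  unfold HandleChart.TransferData.footLift; rw [h.2.1]; exact h.2.2

/-- The ranges of the discs of `M'` are open. [folklore] -/
theorem isOpen_range_footLift' {s : ℝ} (hs : s ^ 2 = 1) : IsOpen (range (C.T'.footLift C.ρ_pos C.hmR' hs)) := by
  have h := isSmoothEmbedding_levelLift C.T'.hcs C.T'.hn (C.S'.D.contMDiff_foot C.T'.hm C.T'.hR C.hmR' C.T'.hball hs C.ρ_pos)
    (C.T'.apply_foot C.ρ_pos C.hmR' hs) C.S'.D.isOpen_footDomain
    (C.S'.D.range_foot hs C.T'.hm C.ρ_pos C.T'.hR C.hmR' C.T'.hball C.T'.hk) (C.S'.D.contMDiffOn_footInv C.ρ_pos)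
    (C.S'.D.footInv_foot hs C.T'.hm C.ρ_pos C.T'.hR C.hmR' C.T'.hball)
  unfold HandleChart.TransferData.footLift; rw [h.2.1]; exact h.2.2

/-- The ranges of the discs are open. [folklore] -/
theorem isOpen_range_disc {s : ℝ} (hs : s ^ 2 = 1) : IsOpen (range (C.disc hs)) := by
  rw [C.disc_def hs, range_comp, range_comp]
  exact C.Ψlev.toHomeomorph.isOpenMap _ (C.Λ.toHomeomorph.isOpenMap _ (C.isOpen_range_footLift hs))

/-- The ranges of the discs of `M'` are open. [folklore] -/
theorem isOpen_range_disc' {s : ℝ} (hs : s ^ 2 = 1) : IsOpen (range (C.disc' hs)) := by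
  rw [C.disc'_def hs, range_comp]
  exact C.Λ'.toHomeomorph.isOpenMap _ (C.isOpen_range_footLift' hs)

/-- The discs are differentiable. [folklore] -/
theorem mdifferentiable_disc {s : ℝ} (hs : s ^ 2 = 1) : MDifferentiable 𝓘(ℝ, 𝔼 n) (𝓡 n) (C.disc hs) :=
  (C.isSmoothEmbedding_disc hs).contMDiff.mdifferentiable (by simp)

/-- The discs of `M'` are differentiable. [folklore] -/
theorem mdifferentiable_disc' {s : ℝ} (hs : s ^ 2 = 1) : MDifferentiable 𝓘(ℝ, 𝔼 n) (𝓡 n) (C.disc' hs) :=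
  (C.isSmoothEmbedding_disc' hs).contMDiff.mdifferentiable (by simp)

/-- The discs have invertible differentials. [folklore] -/
theorem det_mfderiv_disc_ne_zero {s : ℝ} (hs : s ^ 2 = 1) (w : 𝔼 n) :
    LinearMap.det (M := 𝔼 n) (mfderiv 𝓘(ℝ, 𝔼 n) (𝓡 n) (C.disc hs) w).toLinearMap ≠ 0 :=
  det_mfderiv_ne_zero_of_isSmoothEmbedding (C.isSmoothEmbedding_disc hs) (C.isOpen_range_disc hs) w

/-- The discs of `M'` have invertible differentials. [folklore] -/
theorem det_mfderiv_disc'_ne_zero {s : ℝ} (hs : s ^ 2 = 1) (w : 𝔼 n) :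
    LinearMap.det (M := 𝔼 n) (mfderiv 𝓘(ℝ, 𝔼 n) (𝓡 n) (C.disc' hs) w).toLinearMap ≠ 0 :=
  det_mfderiv_ne_zero_of_isSmoothEmbedding (C.isSmoothEmbedding_disc' hs) (C.isOpen_range_disc' hs) w

/-- **The two discs of `M` are disjoint.** [folklore] -/
theorem disjoint_range_disc : Disjoint (range (C.disc (one_pow 2))) (range (C.disc neg_one_sq)) := by
  have hd := C.S.D.disjoint_range_foot (s := 1) (one_pow 2) C.T.hm C.ρ_pos C.T.hR C.hmR C.T.hball
  rw [Set.disjoint_iff]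
  rintro v ⟨⟨w₁, hw₁⟩, ⟨w₂, hw₂⟩⟩
  have h1 := congrArg (fun v => C.Sl.levelIncl (C.Λ.symm (C.Ψlev.symm v))) hw₁
  have h2 := congrArg (fun v => C.Sl.levelIncl (C.Λ.symm (C.Ψlev.symm v))) hw₂
  simp only [disc, Diffeomorph.symm_apply_apply] at h1 h2
  have hm1 : C.Sl.levelIncl (C.Λ.symm (C.Ψlev.symm v)) ∈ range (C.S.D.foot 1 C.m C.ρ) :=
    ⟨w₁, (C.T.footLift_coe C.ρ_pos C.hmR (one_pow 2) w₁).symm.trans h1⟩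
  have hm2 : C.Sl.levelIncl (C.Λ.symm (C.Ψlev.symm v)) ∈ range (C.S.D.foot (-1) C.m C.ρ) :=
    ⟨w₂, (C.T.footLift_coe C.ρ_pos C.hmR neg_one_sq w₂).symm.trans h2⟩
  exact Set.disjoint_iff.1 hd ⟨hm1, hm2⟩

/-- The two discs of `M'` are disjoint. [folklore] -/
theorem disjoint_range_disc' : Disjoint (range (C.disc' (one_pow 2))) (range (C.disc' neg_one_sq)) := by
  have hd := C.S'.D.disjoint_range_foot (s := 1) (one_pow 2) C.T'.hm C.ρ_pos C.T'.hR C.hmR' C.T'.hball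
  rw [Set.disjoint_iff]
  rintro v ⟨⟨w₁, hw₁⟩, ⟨w₂, hw₂⟩⟩
  have h1 := congrArg (fun v => C.Sl'.levelIncl (C.Λ'.symm v)) hw₁
  have h2 := congrArg (fun v => C.Sl'.levelIncl (C.Λ'.symm v)) hw₂
  simp only [disc', Diffeomorph.symm_apply_apply] at h1 h2
  have hm1 : C.Sl'.levelIncl (C.Λ'.symm v) ∈ range (C.S'.D.foot 1 C.m' C.ρ) :=
    ⟨w₁, (C.T'.footLift_coe C.ρ_pos C.hmR' (one_pow 2) w₁).symm.trans h1⟩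
  have hm2 : C.Sl'.levelIncl (C.Λ'.symm v) ∈ range (C.S'.D.foot (-1) C.m' C.ρ) :=
    ⟨w₂, (C.T'.footLift_coe C.ρ_pos C.hmR' neg_one_sq w₂).symm.trans h2⟩
  exact Set.disjoint_iff.1 hd ⟨hm1, hm2⟩

/-! #### Connectedness of the levels -/

omit [IsManifold (𝓡∂ (n + 1)) ∞ M] [IsManifold (𝓡∂ (n + 1)) ∞ M'] in
/-- Connectedness transfers along a homeomorphism. [folklore] -/
theorem connectedSpace_of_homeomorph {α β : Type*} [TopologicalSpace α] [TopologicalSpace β] [ConnectedSpace α] (e : α ≃ₜ β) :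
    ConnectedSpace β :=
  connectedSpace_iff_univ.2 (by rw [← e.surjective.range_eq]; exact isConnected_range e.continuous)

/-- The seed level is connected. [folklore] -/
instance connectedSpace_levelC : ConnectedSpace (C.Sl.Level C.c) := C.Sl.connectedSpace_level rfl C.hconn

/-- The foot level is connected. [folklore] -/
instance connectedSpace_levelFoot : ConnectedSpace (C.Sl.Level (C.S.f C.S.p - C.m)) :=
  connectedSpace_of_homeomorph C.Λ.symm.toHomeomorph

/-- The seed level of `M'` is connected. [folklore] -/
instance connectedSpace_levelC' : ConnectedSpace (C.Sl'.Level (C.c + C.σ)) :=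
  connectedSpace_of_homeomorph C.Ψlev.toHomeomorph

/-- The foot level of `M'` is connected. [folklore] -/
instance connectedSpace_levelFoot' : ConnectedSpace (C.Sl'.Level (C.S'.f C.S'.p - C.m')) :=
  connectedSpace_of_homeomorph C.Λ'.symm.toHomeomorph

/-- The seed level of `M'` is preconnected. [folklore] -/
theorem isPreconnected_univ_levelC' : IsPreconnected (univ : Set (C.Sl'.Level (C.c + C.σ))) := isPreconnected_univ

/-! #### Opposite characters of the two discs of one side -/

/-- **The two discs of `M` have opposite characters in the seed level**, for every orientation
of it. [cite: Kosinski1993, VI (6.6)] -/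
theorem disc_oppositeCharacters (o : SmoothOrientation (𝓡 n) (C.Sl'.Level (C.c + C.σ)))
    (o₀ : Orientation ℝ (𝔼 n) (Fin (finrank ℝ (𝔼 n)))) :
    IsOrientationPreserving (SmoothOrientation.modelSpace o₀) o (C.disc (one_pow 2)) ↔
      IsOrientationPreserving (SmoothOrientation.modelSpace (-o₀)) o (C.disc neg_one_sq) := by
  have hn' : (∞ : ℕ∞ω) ≠ 0 := by simp
  -- at the foot level
  have h0 : ∀ (oV : SmoothOrientation (𝓡 n) (C.Sl.Level (C.S.f C.S.p - C.m))) o₀,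
      IsOrientationPreserving (SmoothOrientation.modelSpace o₀) oV (C.T.footLift C.ρ_pos C.hmR (one_pow 2)) ↔
        IsOrientationPreserving (SmoothOrientation.modelSpace (-o₀)) oV (C.T.footLift C.ρ_pos C.hmR neg_one_sq) :=
    fun oV o₀ => C.T.footLift_isOrientationPreserving_iff_neg_of_connected C.oM oV C.ρ_pos C.hmR o₀
  have hmd := fun {s : ℝ} (hs : s ^ 2 = 1) => ((C.T.isSmoothEmbedding_footLift C.ρ_pos C.hmR hs).contMDiff.mdifferentiable hn')
  -- down the flow
  have h1 := oppositeCharacters_comp C.Λ (hmd (one_pow 2)) (hmd neg_one_sq)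
    (C.T.det_mfderiv_footLift_ne_zero C.ρ_pos C.hmR (one_pow 2)) (C.T.det_mfderiv_footLift_ne_zero C.ρ_pos C.hmR neg_one_sq) h0
  -- across the seed
  exact oppositeCharacters_comp C.Ψlev ((C.Λ.mdifferentiable hn').comp (hmd (one_pow 2)))
    ((C.Λ.mdifferentiable hn').comp (hmd neg_one_sq))
    (det_mfderiv_diffeomorph_comp_ne_zero C.Λ (hmd (one_pow 2)) (C.T.det_mfderiv_footLift_ne_zero C.ρ_pos C.hmR (one_pow 2)))
    (det_mfderiv_diffeomorph_comp_ne_zero C.Λ (hmd neg_one_sq) (C.T.det_mfderiv_footLift_ne_zero C.ρ_pos C.hmR neg_one_sq))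
    h1 o o₀

/-- **The two discs of `M'` have opposite characters in the seed level**, for every orientation
of it. [cite: Kosinski1993, VI (6.6)] -/
theorem disc'_oppositeCharacters (o : SmoothOrientation (𝓡 n) (C.Sl'.Level (C.c + C.σ)))
    (o₀ : Orientation ℝ (𝔼 n) (Fin (finrank ℝ (𝔼 n)))) :
    IsOrientationPreserving (SmoothOrientation.modelSpace o₀) o (C.disc' (one_pow 2)) ↔
      IsOrientationPreserving (SmoothOrientation.modelSpace (-o₀)) o (C.disc' neg_one_sq) := by
  have hn' : (∞ : ℕ∞ω) ≠ 0 := by simp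
  have h0 : ∀ (oV : SmoothOrientation (𝓡 n) (C.Sl'.Level (C.S'.f C.S'.p - C.m'))) o₀,
      IsOrientationPreserving (SmoothOrientation.modelSpace o₀) oV (C.T'.footLift C.ρ_pos C.hmR' (one_pow 2)) ↔
        IsOrientationPreserving (SmoothOrientation.modelSpace (-o₀)) oV (C.T'.footLift C.ρ_pos C.hmR' neg_one_sq) :=
    fun oV o₀ => C.T'.footLift_isOrientationPreserving_iff_neg_of_connected C.oM' oV C.ρ_pos C.hmR' o₀
  have hmd := fun {s : ℝ} (hs : s ^ 2 = 1) => ((C.T'.isSmoothEmbedding_footLift C.ρ_pos C.hmR' hs).contMDiff.mdifferentiable hn')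
  exact oppositeCharacters_comp C.Λ' (hmd (one_pow 2)) (hmd neg_one_sq)
    (C.T'.det_mfderiv_footLift_ne_zero C.ρ_pos C.hmR' (one_pow 2)) (C.T'.det_mfderiv_footLift_ne_zero C.ρ_pos C.hmR' neg_one_sq) h0 o o₀

end OneHandleStepContext

end Literature.Topology.FourManifolds
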